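import Literature.NumberTheory.GaloisCohomology.Howard2004.RelaxedSelmerSelfAnnihilatorProofs
import Literature.NumberTheory.GaloisCohomology.Howard2004.DualityDatumLocalCupScalarReadingFlipProofs
import Literature.NumberTheory.GaloisCohomology.PoitouTateSelmerCountProofs
import HarnessLib

/-!
# Howard 2004, Lemma 1.5.6 at an inert prime: the count `#A · #A = #H¹(K_q, T)` for the Lagrangian
# `A = loc_q H¹_𝓡(K, T)`, and the non-degenerate pairing `(x, a) ↦ x ∪_e transport_q(a)` (proofs file)

Topic `NumberTheory/GaloisCohomology/Howard2004`. THEOREMS ONLY: no definition, no named fact, no instance, no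
notation, no `sorry`. Sequel to `RelaxedSelmerSelfAnnihilatorProofs` («`A = A^⟂`», p697129); cell
`pub/bsd-print-x9`, print leaf G87 `Literature.NumberTheory.GaloisCohomology.Howard2004.thm161_dvrKolyvaginBound`
(Howard Thm. 1.6.1); seat `bsd-line-x9-p1-w4` g16, brick (A-PERP-COUNT).

SOURCE. B. Howard, *The Heegner point Kolyvagin system*, Compositio Math. **140** (2004) = arXiv:1202.6340,
Lemma 1.5.6 (arXiv Lemma 2.5.6, p. 10 L93–97): «By global duality `len(A) = … = 2k·ν(m)`. The sum of the
lengths of `A` and `A^⟂` must be `4k·ν(m)` and we conclude that `len(A) = len(A^⟂)` and so `A = A^⟂`.» In the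
tree the order is reversed: `A = A^⟂` is a kernel theorem from the element form of Thm. 1.1.11
(`RelaxedSelmerSelfAnnihilatorProofs`), and the COUNT «`#A · #A^⟂ = #H¹(K_q, T)`, hence `#A² = #H¹(K_q, T)`» is
its corollary through local Tate duality (Milne I Cor. 2.3: the `ℤ/p^k`-reading of `∪_e` is perfect) — this file.
Lemma 1.5.7 (p. 10 L105–127) then uses the induced local pairing of H.4 at the inert `q`,
`(x, a) ↦ ⟨x, a⟩_q = x ∪_e transport_q(a)` on `H¹(K_q, T) × H¹(K_q, T)`, as a non-degenerate `R`-bilinear form.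

WHAT IS PROVED (H.4 datum `D : DualityDatum p cd ρ R` on a finite `T` killed by `p^k`, `(λ, exp)` as in
`DualityDatumTateDualBridge`, `Θ = D.toTateDual λ exp` bijective, `(r_i)` a dualizing family of `R`,
`inv : LocalInvariants K (p^k)` with `IsPerfect` (local Tate duality) where readings are taken):
* §1 `ConjugationDatum.transportH1_scalarMapH1` — Howard's transport `H¹(K_{σv}, T) → H¹(K_v, Tw T)` commutes
  with the functorial scalar action (`δ_v` acts `R`-linearly); `cast_scalarMapH1` (the place cast of
  `InertLocalTauProofs` commutes with the scalars); so `T_q := transport_q ∘ (σ q = q ▸ ·)` is `R`-linear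
  (`transportH1_cast_scalarMapH1`), additive and bijective (`transportH1_cast_add`, `transportH1_cast_bijective`).
* §2 **(hnd)** `DualityDatum.eq_zero_of_forall_localCup_transportH1_cast_eq_zero[_right]`: both kernels of
  `(x, a) ↦ x ∪_e T_q a` on `H¹(K_q, T) × H¹(K_q, T)` are trivial (tree (Nondeg) for `∪_e` + `T_q` bijective).
* §1b `scalarMapH1_mem_selmerGroup_of_eq_off` (the Selmer group of `𝓡` is `r`-stable when its finite local
  conditions off `q` are and `𝓡_q = ⊤`, infinite localizations vanishing); `natCard_…_eq_of_eq` (place casts).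
* §3 **`DualityDatum.forall_reading_eq_zero_iff_mem_map_localization`**: for the `ℤ/p^k`-READING
  `b(x, y) = inv_q H²(exp ∘ λ)(x ∪_e y)` and `X = transport_q(loc_{σq} H¹_𝓡(K, T)) ≤ H¹(K_q, Tw T)`, the annihilator of
  `X` in `H¹(K_q, T)` is exactly `A = loc_q H¹_𝓡(K, T)` (family readout + «`A = A^⟂`»).
* §4 **`DualityDatum.natCard_map_localization_selmerGroup_mul_self`**: `#A · #A = #H¹(K_q, T)` — from
  `natCard_annihilator_mul_natCard` (tree, Milne I Prop. 0.19) for the perfect reading pairing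
  (`injective_localCupZMod`, `exists_forall_reading_localCup_eq_flip`), `#X = #A` (transport injective, `σ q = q`)
  and `#H¹(K_q, Tw T) = #H¹(K_q, T)` (transport bijective).  On the residual `T̄` (a `k`-vector space,
  `ResidualDualityDatumProofs`) this is «`dim_k loc_q H¹_{F̄^q(n)}(K, T̄) = ½ dim_k H¹(K_q, T̄)`», the count behind
  Lemma 1.5.3's «maximal isotropic subspace» sentence (p. 10 L33–36).

NOT HERE: the symmetry of `⟨ , ⟩_q` (H.4 «equivalently … symmetric», p. 7 L74–77), lengths over `R` (the consumer
converts cardinalities of `R/ϖ^k`-modules), the eigen-splitting of Lemma 1.5.3; `thm161_dvrKolyvaginBound` is NOT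
proved; no summit statement is proved; the Birch–Swinnerton-Dyer conjecture is not proved by any of this.
References: [Howard2004HeegnerKolyvagin] Lemma 1.5.6, Lemma 1.5.7, Lemma 1.5.3, §1.3 H.4; [MilneADT2006] I Prop. 0.19,
I Cor. 2.3; [SerreGaloisCohomology1997] I §2.2–2.4, §5.1.
-/

set_option autoImplicit false

noncomputable section

open Function NumberField IsDedekindDomain Field CategoryTheory
open scoped NumberField

namespace Literature.NumberTheory.GaloisCohomology.Howard2004

open Literature.NumberTheory.GaloisRepresentations
open Literature.NumberTheory.GaloisRepresentations.DiscreteGaloisModule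
open Literature.NumberTheory.EllipticCurves

variable {K : Type} [Field K] [NumberField K] {M : Type} [AddCommGroup M] [TopologicalSpace M]
  [DiscreteTopology M] {R : Type} [CommRing R] [Module R M]

/-! ## §1 The transport and the place cast commute with the scalars -/

namespace ConjugationDatum

/-- **`transport_v (r • z) = r • transport_v z`**: Howard's transport `H¹(K_{σ v}, T) → H¹(K_v, Tw T)` commutes with
the functorial scalar action (on cocycles both are `h ↦ δ_v · r · c(φ_v h) = r · δ_v · c(φ_v h)`, `ρ(δ_v)` being
`R`-linear). [cite: Howard2004HeegnerKolyvagin, §1.3 (arXiv p. 7 L44–48) and Def. 1.1.1 (local conditions are R-submodules)] [cite: SerreGaloisCohomology1997, Ch. I §2.4 (compatible pairs)] -/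
theorem transportH1_scalarMapH1 (cd : ConjugationDatum K) (ρ : DiscreteGaloisModule K M)
    (hρ : ρ.IsScalarLinear R) (v : HeightOneSpectrum (𝓞 K)) (r : R)
    (z : galoisCohomology (ρ.toLocal (Sum.inr (cd.σ • v))) 1) :
    cd.transportH1 ρ v (galoisCohomology.scalarMapH1 (ρ.toLocal (Sum.inr (cd.σ • v)))
        (DualityDatum.isScalarLinear_toLocal hρ (Sum.inr (cd.σ • v))) r z) =
      galoisCohomology.scalarMapH1 ((cd.twist ρ).toLocal (Sum.inr v))
        (DualityDatum.isScalarLinear_twist_toLocal cd hρ (Sum.inr v)) r (cd.transportH1 ρ v z) := by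
  obtain ⟨c, rfl⟩ := oneCocycleClass_surjective _ z
  rw [galoisCohomology.scalarMapH1_oneCocycleClass, transportH1_oneCocycleClass, transportH1_oneCocycleClass]
  refine Eq.trans ?_ (galoisCohomology.scalarMapH1_oneCocycleClass _ _ r _).symm
  refine congrArg _ (Subtype.ext (ContinuousMap.ext fun h => ?_))
  change ρ (cd.δ v) (r • c.1 (cd.φ v h)) = r • ρ (cd.δ v) (c.1 (cd.φ v h))
  exact hρ (cd.δ v) r _

end ConjugationDatum

section Cast

variable (ρ : DiscreteGaloisModule K M)

/-- The place cast along `v = w` commutes with the functorial scalar action.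
[cite: Howard2004HeegnerKolyvagin, §1.3 (arXiv p. 7 L44–48: «`v̄ = v^τ`» at a degree-two prime, §1.2 p. 6 L54–56)] -/
theorem cast_scalarMapH1 (hρ : ρ.IsScalarLinear R) {v w : HeightOneSpectrum (𝓞 K)} (h : v = w) (r : R)
    (x : galoisCohomology (ρ.toLocal (Sum.inr v)) 1) :
    (h ▸ galoisCohomology.scalarMapH1 (ρ.toLocal (Sum.inr v))
        (DualityDatum.isScalarLinear_toLocal hρ (Sum.inr v)) r x :
        galoisCohomology (ρ.toLocal (Sum.inr w)) 1) =
      galoisCohomology.scalarMapH1 (ρ.toLocal (Sum.inr w)) (DualityDatum.isScalarLinear_toLocal hρ (Sum.inr w)) r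
        (h ▸ x : galoisCohomology (ρ.toLocal (Sum.inr w)) 1) := by
  subst h
  rfl

/-- `#H¹(K_v, T) = #H¹(K_w, T)` along `v = w`.
[cite: Howard2004HeegnerKolyvagin, §1.3 (arXiv p. 7 L44–48: «`v̄ = v^τ`» at a degree-two prime, §1.2 p. 6 L54–56)] -/
theorem natCard_galoisCohomology_toLocal_eq_of_eq {v w : HeightOneSpectrum (𝓞 K)} (h : v = w) :
    Nat.card (galoisCohomology (ρ.toLocal (Sum.inr v)) 1) = Nat.card (galoisCohomology (ρ.toLocal (Sum.inr w)) 1) := by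
  subst h
  rfl

/-- `#loc_v(S) = #loc_w(S)` along `v = w`, for a subgroup `S ≤ H¹(K, T)`.
[cite: Howard2004HeegnerKolyvagin, §1.3 (arXiv p. 7 L44–48: «`v̄ = v^τ`» at a degree-two prime, §1.2 p. 6 L54–56)] -/
theorem natCard_map_localization_eq_of_eq (S : AddSubgroup (galoisCohomology ρ 1)) {v w : HeightOneSpectrum (𝓞 K)}
    (h : v = w) :
    Nat.card (S.map (galoisCohomology.localization ρ (Sum.inr v) 1)) =
      Nat.card (S.map (galoisCohomology.localization ρ (Sum.inr w) 1)) := by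
  subst h
  rfl

end Cast

/-! ## §1b The Selmer group of a structure with `R`-stable local conditions is `R`-stable -/

/-- **The Selmer group of `𝓡` is `r`-stable** when the local conditions `𝓕_v = 𝓡_v` at the finite `v ≠ q` are, `𝓡_q` is
everything and all classes localise to `0` at the infinite places (Howard Def. 1.1.1: local conditions are
`R`-submodules). [cite: Howard2004HeegnerKolyvagin, Def. 1.1.1 (arXiv p. 5 L20–24) and Def. 1.1.10] -/
theorem scalarMapH1_mem_selmerGroup_of_eq_off {ρ : DiscreteGaloisModule K M} (hρ : ρ.IsScalarLinear R)
    (𝓕 𝓡 : SelmerStructure ρ)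
    {q : HeightOneSpectrum (𝓞 K)} (hrel : 𝓡 (Sum.inr q) = ⊤)
    (hoff : ∀ v : HeightOneSpectrum (𝓞 K), v ≠ q → 𝓡 (Sum.inr v) = 𝓕 (Sum.inr v)) (r : R)
    (hstab : ∀ v : HeightOneSpectrum (𝓞 K), v ≠ q → ∀ a ∈ 𝓕 (Sum.inr v),
      galoisCohomology.scalarMapH1 (ρ.toLocal (Sum.inr v)) (DualityDatum.isScalarLinear_toLocal hρ (Sum.inr v)) r a ∈
        𝓕 (Sum.inr v))
    (hinf : ∀ (w : InfinitePlace K) (c : galoisCohomology ρ 1), galoisCohomology.localization ρ (Sum.inl w) 1 c = 0)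
    {d : galoisCohomology ρ 1} (hd : d ∈ 𝓡.selmerGroup) :
    galoisCohomology.scalarMapH1 ρ hρ r d ∈ 𝓡.selmerGroup := by
  rw [SelmerStructure.mem_selmerGroup_iff] at hd ⊢
  rintro (w | v)
  · rw [hinf]; exact zero_mem _
  · by_cases hv : v = q
    · rw [hv, hrel]; trivial
    · rw [galoisCohomology.localization_scalarMapH1 hρ (Sum.inr v) r d, hoff v hv]
      exact hstab v hv _ (hoff v hv ▸ hd (Sum.inr v))


namespace ConjugationDatum

/-- **`T_q := transport_q ∘ (σ q = q ▸ ·)` is `R`-linear** on `H¹(K_q, T)`.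
[cite: Howard2004HeegnerKolyvagin, §1.3 (arXiv p. 7 L44–48) and Def. 1.1.1] -/
theorem transportH1_cast_scalarMapH1 (cd : ConjugationDatum K) (ρ : DiscreteGaloisModule K M)
    (hρ : ρ.IsScalarLinear R) {q : HeightOneSpectrum (𝓞 K)} (hq : cd.σ • q = q) (r : R)
    (a : galoisCohomology (ρ.toLocal (Sum.inr q)) 1) :
    cd.transportH1 ρ q (hq.symm ▸ galoisCohomology.scalarMapH1 (ρ.toLocal (Sum.inr q))
        (DualityDatum.isScalarLinear_toLocal hρ (Sum.inr q)) r a :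
        galoisCohomology (ρ.toLocal (Sum.inr (cd.σ • q))) 1) =
      galoisCohomology.scalarMapH1 ((cd.twist ρ).toLocal (Sum.inr q))
        (DualityDatum.isScalarLinear_twist_toLocal cd hρ (Sum.inr q)) r
        (cd.transportH1 ρ q (hq.symm ▸ a : galoisCohomology (ρ.toLocal (Sum.inr (cd.σ • q))) 1)) := by
  rw [cast_scalarMapH1 ρ hρ hq.symm r a, cd.transportH1_scalarMapH1 ρ hρ q r]

/-- `T_q` is additive. [cite: Howard2004HeegnerKolyvagin, §1.3 (arXiv p. 7 L44–48)] -/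
theorem transportH1_cast_add (cd : ConjugationDatum K) (ρ : DiscreteGaloisModule K M)
    {q : HeightOneSpectrum (𝓞 K)} (hq : cd.σ • q = q) (a b : galoisCohomology (ρ.toLocal (Sum.inr q)) 1) :
    cd.transportH1 ρ q (hq.symm ▸ (a + b) : galoisCohomology (ρ.toLocal (Sum.inr (cd.σ • q))) 1) =
      cd.transportH1 ρ q (hq.symm ▸ a : galoisCohomology (ρ.toLocal (Sum.inr (cd.σ • q))) 1) +
        cd.transportH1 ρ q (hq.symm ▸ b : galoisCohomology (ρ.toLocal (Sum.inr (cd.σ • q))) 1) := by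
  rw [cast_add ρ hq.symm a b, map_add]

/-- **`T_q` is bijective** (`transportH1_bijective` and the cast round trips of `InertLocalTauProofs`).
[cite: Howard2004HeegnerKolyvagin, §1.3 (arXiv p. 7 L48–50: «induces an isomorphism»)] -/
theorem transportH1_cast_bijective (cd : ConjugationDatum K) (ρ : DiscreteGaloisModule K M)
    {q : HeightOneSpectrum (𝓞 K)} (hq : cd.σ • q = q) :
    Bijective fun a : galoisCohomology (ρ.toLocal (Sum.inr q)) 1 =>
      cd.transportH1 ρ q (hq.symm ▸ a : galoisCohomology (ρ.toLocal (Sum.inr (cd.σ • q))) 1) := by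
  constructor
  · intro a b h
    have h' := cd.transportH1_injective ρ q h
    have := congrArg (fun z : galoisCohomology (ρ.toLocal (Sum.inr (cd.σ • q))) 1 =>
      (hq.symm.symm ▸ z : galoisCohomology (ρ.toLocal (Sum.inr q)) 1)) h'
    simpa only [cast_symm_cast ρ hq.symm] using this
  · intro y
    obtain ⟨z, rfl⟩ := cd.transportH1_surjective ρ q y
    refine ⟨(hq ▸ z : galoisCohomology (ρ.toLocal (Sum.inr q)) 1), ?_⟩
    change cd.transportH1 ρ q (hq.symm ▸ (hq ▸ z : galoisCohomology (ρ.toLocal (Sum.inr q)) 1)) = _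
    rw [cast_symm_cast ρ hq z]

end ConjugationDatum

namespace DualityDatum

variable [TopologicalSpace R] [DiscreteTopology R]
  {p : ℕ} [Fact p.Prime] [Algebra ℤ_[p] R] {cd : ConjugationDatum K} {ρ : DiscreteGaloisModule K M}
  [Finite M] (D : DualityDatum p cd ρ R) {k : ℕ}
  (lam : R →+ ZMod (p ^ k))
  (hlam : ∀ (z : ℤ_[p]) (r : R), lam (algebraMap ℤ_[p] R z * r) = PadicInt.toZModPow k z * lam r)
  (exp : ZMod (p ^ k) →+ MuCarrier K (p ^ k))
  (hexp : ∀ (g : absoluteGaloisGroup K) (x : ZMod (p ^ k)),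
    exp (cyclotomicCharacterModPow K p k g * x) = mu K (p ^ k) g (exp x))

/-! ## §2 (hnd): both kernels of `(x, a) ↦ x ∪_e T_q a` are trivial -/

/-- **(hnd, left)**: if `x ∪_e transport_q(a) = 0` for every `a ∈ H¹(K_q, T)` then `x = 0` (local Tate duality for the
reading against `inv_q` — `IsPerfect` — through (Nondeg) for `∪_e`, `T_q` being onto).
[cite: Howard2004HeegnerKolyvagin, §1.3 H.4 (arXiv p. 7 L69–82: «perfect») and Lemma 1.5.7 (p. 10 L105–127)] [cite: MilneADT2006, Ch. I Cor. 2.3] -/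
theorem eq_zero_of_forall_localCup_transportH1_cast_eq_zero (hn : ∀ m : M, (p ^ k) • m = 0)
    (hΘ : Bijective (D.toTateDual lam hlam exp hexp)) (inv : LocalInvariants K (p ^ k)) (hperf : inv.IsPerfect)
    {q : HeightOneSpectrum (𝓞 K)} (hq : cd.σ • q = q) (x : galoisCohomology (ρ.toLocal (Sum.inr q)) 1)
    (hx : ∀ a : galoisCohomology (ρ.toLocal (Sum.inr q)) 1, D.localCup (Sum.inr q) x
      (cd.transportH1 ρ q (hq.symm ▸ a : galoisCohomology (ρ.toLocal (Sum.inr (cd.σ • q))) 1)) = 0) :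
    x = 0 := by
  refine (D.eq_zero_of_forall_localCup_eq_zero_of_isPerfect lam hlam exp hexp q hn hΘ inv hperf).1 x fun y => ?_
  obtain ⟨a, rfl⟩ := (cd.transportH1_cast_bijective ρ hq).2 y
  exact hx a

/-- **(hnd, right)**: if `x ∪_e transport_q(a) = 0` for every `x ∈ H¹(K_q, T)` then `a = 0`.
[cite: Howard2004HeegnerKolyvagin, §1.3 H.4 (arXiv p. 7 L69–82: «perfect») and Lemma 1.5.7 (p. 10 L105–127)] [cite: MilneADT2006, Ch. I Cor. 2.3] -/
theorem eq_zero_of_forall_localCup_transportH1_cast_eq_zero_right (hn : ∀ m : M, (p ^ k) • m = 0)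
    (hΘ : Bijective (D.toTateDual lam hlam exp hexp)) (inv : LocalInvariants K (p ^ k)) (hperf : inv.IsPerfect)
    {q : HeightOneSpectrum (𝓞 K)} (hq : cd.σ • q = q) (a : galoisCohomology (ρ.toLocal (Sum.inr q)) 1)
    (ha : ∀ x : galoisCohomology (ρ.toLocal (Sum.inr q)) 1, D.localCup (Sum.inr q) x
      (cd.transportH1 ρ q (hq.symm ▸ a : galoisCohomology (ρ.toLocal (Sum.inr (cd.σ • q))) 1)) = 0) :
    a = 0 := by
  have h0 := (D.eq_zero_of_forall_localCup_eq_zero_of_isPerfect lam hlam exp hexp q hn hΘ inv hperf).2 _ ha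
  have h1 : cd.transportH1 ρ q (hq.symm ▸ a : galoisCohomology (ρ.toLocal (Sum.inr (cd.σ • q))) 1) =
      cd.transportH1 ρ q (hq.symm ▸ (0 : galoisCohomology (ρ.toLocal (Sum.inr q)) 1) :
        galoisCohomology (ρ.toLocal (Sum.inr (cd.σ • q))) 1) := by
    rw [h0, cast_zero ρ hq.symm, map_zero]
  exact (cd.transportH1_cast_bijective ρ hq).1 h1

/-! ## §3 The reading annihilator of `transport_q(loc_{σq} H¹_𝓡)` is `A = loc_q H¹_𝓡` -/

/-- **The `ℤ/p^k`-reading annihilator of `X = transport_q(loc_{σq} H¹_𝓡(K, T))` in `H¹(K_q, T)` is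
`A = loc_q H¹_𝓡(K, T)`**: for `x ∈ H¹(K_q, T)`, `inv_q H²(exp ∘ λ)(x ∪_e y) = 0` for all `y ∈ X` iff `x ∈ A` — «⇐» is
«`A ⊆ A^⟂`», «⇒» reads the vanishing for `r_i • d` (the Selmer group is `r_i`-stable and transport/localization commute
with the scalars) through `H²(exp ∘ λ_{r_i})(x ∪ t) = H²(exp ∘ λ)(x ∪ r_i • t)` and the family readout, and applies
«`A^⟂ ⊆ A`» (`RelaxedSelmerSelfAnnihilatorProofs`).
[cite: Howard2004HeegnerKolyvagin, Lemma 1.5.6 (arXiv:1202.6340 Lemma 2.5.6, p. 10 L80–97)] [cite: MilneADT2006, Ch. I Cor. 2.3] -/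
theorem forall_reading_eq_zero_iff_mem_map_localization
    (hn : ∀ m : M, (p ^ k) • m = 0) (hρ : ρ.IsScalarLinear R)
    (inv : LocalInvariants K (p ^ k)) (hPT : inv.SumLocalTermEqZero) (hSC : inv.SelmerComplement)
    (hperf : inv.IsPerfect) (hΘ : Bijective (D.toTateDual lam hlam exp hexp))
    {ι : Type} [Finite ι] (r : ι → R) (hbij : Bijective fun x : R => fun i : ι => exp (lam (r i * x)))
    (S : Finset (Place K))
    (hS : ∀ v : HeightOneSpectrum (𝓞 K), (Sum.inr v : Place K) ∉ S →
      ((p ^ k : ℕ) : 𝓞 K) ∉ v.asIdeal ∧ GaloisRep.IsUnramifiedAt v ρ)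
    (𝓕 𝓡 : SelmerStructure ρ) {q : HeightOneSpectrum (𝓞 K)} (hq : cd.σ • q = q)
    (hqS : (Sum.inr q : Place K) ∈ S) (h𝓡S : 𝓡.IsUnramifiedOutside S)
    (hrel : 𝓡 (Sum.inr q) = ⊤)
    (hoff : ∀ v : HeightOneSpectrum (𝓞 K), v ≠ q → 𝓡 (Sum.inr v) = 𝓕 (Sum.inr v))
    (horth : ∀ v : HeightOneSpectrum (𝓞 K), v ≠ q → D.IsSelfOrthogonalAt 𝓕 v)
    (hstab : ∀ v : HeightOneSpectrum (𝓞 K), v ≠ q → ∀ i, ∀ a ∈ 𝓕 (Sum.inr v),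
      galoisCohomology.scalarMapH1 (ρ.toLocal (Sum.inr v)) (isScalarLinear_toLocal hρ (Sum.inr v)) (r i) a ∈
        𝓕 (Sum.inr v))
    (hinf : ∀ (w : InfinitePlace K) (c : galoisCohomology ρ 1),
      galoisCohomology.localization ρ (Sum.inl w) 1 c = 0)
    (x : galoisCohomology (ρ.toLocal (Sum.inr q)) 1) :
    (∀ y ∈ (𝓡.selmerGroup.map (galoisCohomology.localization ρ (Sum.inr (cd.σ • q)) 1)).map (cd.transportH1 ρ q),
        inv (Sum.inr q) (cohomologyMap (D.expLamLocalHom lam hlam exp hexp (Sum.inr q)) 2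
          (D.localCup (Sum.inr q) x y)) = 0) ↔
      x ∈ 𝓡.selmerGroup.map (galoisCohomology.localization ρ (Sum.inr q) 1) := by
  rw [D.mem_map_localization_selmerGroup_iff_forall_localCup_eq_zero lam hlam exp hexp hn hρ inv hPT hSC
    (fun v => (hperf v).1.1) hΘ r hbij S hS 𝓕 𝓡 hq hqS h𝓡S hrel hoff horth hstab hinf x]
  constructor
  · intro h d hd
    -- read the vanishing for `r_i • d` through `λ_{r_i}` and detect
    refine D.eq_zero_of_forall_cohomologyMap_expLam_lamMul_eq_zero lam hlam exp hexp r hbij (Sum.inr q) _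
      fun i => ?_
    rw [D.cohomologyMap_expLam_lamMul_localCup lam hlam exp hexp hρ (Sum.inr q) (r i),
      ← cd.transportH1_scalarMapH1 ρ hρ q (r i),
      ← galoisCohomology.localization_scalarMapH1 hρ (Sum.inr (cd.σ • q)) (r i) d]
    refine (hperf q).1.1 ((h _ ⟨_, ⟨_, scalarMapH1_mem_selmerGroup_of_eq_off hρ 𝓕 𝓡 hrel hoff (r i)
      (fun v hv => hstab v hv i) hinf hd, rfl⟩, rfl⟩).trans (map_zero _).symm)
  · rintro h y ⟨z, ⟨d, hd, rfl⟩, rfl⟩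
    rw [h d hd]
    exact (congrArg (inv (Sum.inr q)) (map_zero _)).trans (map_zero _)

/-! ## §4 The count `#A · #A = #H¹(K_q, T)` -/

/-- **Howard 2004, Lemma 1.5.6, the count: `#A · #A = #H¹(K_q, T)` for `A = loc_q H¹_𝓡(K, T)`** at an inert prime
`q` (the structure `𝓡` relaxed at `q`, self-orthogonal and `r_i`-stable off `q`; hypotheses of
`mem_map_localization_selmerGroup_iff_forall_localCup_eq_zero` with `IsPerfect`).  «The sum of the lengths of `A` and
`A^⟂` must be `4k·ν(m)` … `len(A) = len(A^⟂)`»: here from `A = A^⟂` and `#A^⟂ · #X = #H¹(K_q, Tw T)` for the perfect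
`ℤ/p^k`-reading of `∪_e` (Milne I Prop. 0.19 / Cor. 2.3), `#X = #A`, `#H¹(K_q, Tw T) = #H¹(K_q, T)`.
[cite: Howard2004HeegnerKolyvagin, Lemma 1.5.6 (arXiv:1202.6340 Lemma 2.5.6, p. 10 L93–97)] [cite: MilneADT2006, Ch. I Prop. 0.19 and Cor. 2.3] -/
theorem natCard_map_localization_selmerGroup_mul_self
    (hn : ∀ m : M, (p ^ k) • m = 0) (hρ : ρ.IsScalarLinear R)
    (inv : LocalInvariants K (p ^ k)) (hPT : inv.SumLocalTermEqZero) (hSC : inv.SelmerComplement)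
    (hperf : inv.IsPerfect) (hΘ : Bijective (D.toTateDual lam hlam exp hexp))
    {ι : Type} [Finite ι] (r : ι → R) (hbij : Bijective fun x : R => fun i : ι => exp (lam (r i * x)))
    (S : Finset (Place K))
    (hS : ∀ v : HeightOneSpectrum (𝓞 K), (Sum.inr v : Place K) ∉ S →
      ((p ^ k : ℕ) : 𝓞 K) ∉ v.asIdeal ∧ GaloisRep.IsUnramifiedAt v ρ)
    (𝓕 𝓡 : SelmerStructure ρ) {q : HeightOneSpectrum (𝓞 K)} (hq : cd.σ • q = q)
    (hqS : (Sum.inr q : Place K) ∈ S) (h𝓡S : 𝓡.IsUnramifiedOutside S)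
    (hrel : 𝓡 (Sum.inr q) = ⊤)
    (hoff : ∀ v : HeightOneSpectrum (𝓞 K), v ≠ q → 𝓡 (Sum.inr v) = 𝓕 (Sum.inr v))
    (horth : ∀ v : HeightOneSpectrum (𝓞 K), v ≠ q → D.IsSelfOrthogonalAt 𝓕 v)
    (hstab : ∀ v : HeightOneSpectrum (𝓞 K), v ≠ q → ∀ i, ∀ a ∈ 𝓕 (Sum.inr v),
      galoisCohomology.scalarMapH1 (ρ.toLocal (Sum.inr v)) (isScalarLinear_toLocal hρ (Sum.inr v)) (r i) a ∈
        𝓕 (Sum.inr v))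
    (hinf : ∀ (w : InfinitePlace K) (c : galoisCohomology ρ 1),
      galoisCohomology.localization ρ (Sum.inl w) 1 c = 0) :
    Nat.card (𝓡.selmerGroup.map (galoisCohomology.localization ρ (Sum.inr q) 1)) *
        Nat.card (𝓡.selmerGroup.map (galoisCohomology.localization ρ (Sum.inr q) 1)) =
      Nat.card (galoisCohomology (ρ.toLocal (Sum.inr q)) 1) := by
  haveI : NeZero (p ^ k) := ⟨pow_ne_zero k (Fact.out : p.Prime).ne_zero⟩
  haveI := finite_galoisCohomology_one_toLocal ρ q
  haveI := finite_galoisCohomology_one_toLocal (cd.twist ρ) q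
  -- the perfect reading pairing `b(x, y) = inv_q H²(exp ∘ λ)(x ∪_e y)`
  obtain ⟨b, hb_def⟩ : ∃ b : galoisCohomology (ρ.toLocal (Sum.inr q)) 1 →+
      galoisCohomology ((cd.twist ρ).toLocal (Sum.inr q)) 1 →+ ZMod (p ^ k),
      b = (localTatePairingZMod ρ (p ^ k) (Sum.inr q) (inv (Sum.inr q))).compl₂
        (galoisCohomology.map (EllipticCurves.DiscreteGaloisModule.localMap (D.toTateDual lam hlam exp hexp)
          (Sum.inr q)) 1) := ⟨_, rfl⟩
  have hb_apply : ∀ x y, b x y = inv (Sum.inr q) (cohomologyMap (D.expLamLocalHom lam hlam exp hexp (Sum.inr q)) 2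
      (D.localCup (Sum.inr q) x y)) := fun x y => by
    rw [hb_def, AddMonoidHom.compl₂_apply, localTatePairingZMod_apply,
      D.cohomologyMap_localCup_eq_localTatePairing lam hlam exp hexp]
  have hb : Bijective b := by
    refine ⟨?_, fun χ => ?_⟩
    · rw [hb_def]
      exact D.injective_localCupZMod lam hlam exp hexp hΘ (Sum.inr q) (inv (Sum.inr q)) ((hperf q).2 ρ hn).1.1
    · obtain ⟨x, hx⟩ := D.exists_forall_reading_localCup_eq_flip lam hlam exp hexp hn hΘ q (inv (Sum.inr q))
        ((hperf q).2 ρ hn).1.1 ((hperf q).2 ρ hn).2.1 χ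
      exact ⟨x, AddMonoidHom.ext fun y => by rw [hb_apply, hx y]⟩
  -- `#A · #X = #H¹(K_q, Tw T)`
  have hcount := natCard_annihilator_mul_natCard
    (fun y => galoisCohomology.nsmul_eq_zero_of_forall ((cd.twist ρ).toLocal (Sum.inr q)) hn y) b hb
    ((𝓡.selmerGroup.map (galoisCohomology.localization ρ (Sum.inr (cd.σ • q)) 1)).map (cd.transportH1 ρ q))
    (𝓡.selmerGroup.map (galoisCohomology.localization ρ (Sum.inr q) 1)) fun a => by
      rw [← D.forall_reading_eq_zero_iff_mem_map_localization lam hlam exp hexp hn hρ inv hPT hSC hperf hΘ r hbij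
        S hS 𝓕 𝓡 hq hqS h𝓡S hrel hoff horth hstab hinf a]
      simp only [hb_apply]
  -- `#X = #A` and `#H¹(K_q, Tw T) = #H¹(K_q, T)`
  rw [AddSubgroup.card_map_of_injective (cd.transportH1_injective ρ q),
    natCard_map_localization_eq_of_eq ρ 𝓡.selmerGroup hq,
    ← Nat.card_eq_of_bijective _ (cd.transportH1_bijective ρ q),
    natCard_galoisCohomology_toLocal_eq_of_eq ρ hq] at hcount
  exact hcount

end DualityDatum

end Literature.NumberTheory.GaloisCohomology.Howard2004

end
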